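import Literature.AlgebraicGeometry.HodgeTheory.HodgeGroupSemisimpleOfNoTypeIVFactor
import Literature.AlgebraicGeometry.Deligne1982.WeilTypeCMHodgeGroupLeSU
import Literature.AlgebraicGeometry.HodgeTheory.WeilClassesMoonenZarhinCriterionHolds
import Mathlib.RingTheory.Adjoin.Polynomial.Basic
import HarnessLib

/-!
# `W_F` Hodge for a subfield `F ⊇ E = Z(End⁰ X)` ⟹ the Hodge group is semisimple (Moonen–Zarhin 1998, §1,
# Remark (1) after Criterion (2): «if `F′ ⊇ E` … `W_{F′}` consists of Hodge classes iff `Hdg` is semi-simple»)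

Layer `Literature/AlgebraicGeometry/HodgeTheory`, theorem-only (no definition, no named fact, no `sorry`).

PRINTED STATEMENT.  B. J. J. Moonen – Yu. G. Zarhin, *Weil classes on abelian varieties*, J. reine angew. Math. 496
(1998) 83–92 = arXiv:alg-geom/9612017 (held text `paper:arxiv-alg-geom_9612017`, chunk p0004, Remark (1)): «Suppose we have
two subfields `F ⊆ F′ ⊆ End⁰(X)`. … it follows directly from Criterion (crit1) that `W_{F′}` consists of Hodge classes ⟹
`W_F` consists of Hodge classes.  Moreover, if `F′ ⊇ E`, then the converse is true.  To see this, let us recall that the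
center `Z(Hdg)` of the Hodge group is contained in the torus `U_E`, and that the action of `Hdg` on `W_F` is given by the
`F`-linear determinant.  Therefore, if `E ⊂ F′`, then `W_{F′}` consists of Hodge classes if and only if `Hdg` is
semi-simple.»  (`E` = the centre of `D = End⁰(Y)`, `X ∼ Yᵐ`; Lemma (1): «The center of `G_div(X)` is the group
`U_{K_B}` … in all other cases it is finite».)

RENDERING.  `A` a complex abelian variety; `F′ = ℚ(φ)` with `P(φ) = 0`, `P ∈ ℤ[T]` monic irreducible of degree `e`,
`e · 2m = 2 dim A`; `W_{F′} ⊗ ℂ = weilClassesField A φ P (2m)`, «consists of Hodge classes» = `≤ hodgeClassSpan A.dim A.X m`;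
«`E ⊂ F′`» is rendered on `H¹(A(ℂ); ℂ)` as: EVERY CENTRAL PULL-BACK `u^*` (`u ∈ End(A)`, `u^* ∈ C(A) ⊗ ℂ =
Milne1999.centralizerAlgebra A`) IS A POLYNOMIAL IN `φ^*` (`∈ Algebra.adjoin ℂ {φ^*}`; `Z(End⁰ A) ⊗ ℂ ⊆ F′ ⊗ ℂ`, which
for the semisimple `φ^*` is equivalent to `Z(End⁰ A) ⊆ F′ = ℚ(φ)`); «`Hdg` is semi-simple» is the tree's
`HasSemisimpleHodgeGroup A` (the centre of the Tannaka-free Hodge group `Hg(A)(ℂ) ≤ ∏ₖ GL(Hᵏ)` is FINITE,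
`HodgeTheory/HodgeGroupProductSemisimpleCMFactor`), reached through `Hg|_{H¹} = VanGeemen1994.hodgeGroupOne` and the
tree's transfer `VanGeemen1994.finite_center_hodgeGroup_of_hodgeGroupOne`.

WHAT IS PROVED — the direction «`W_{F′}` Hodge ⟹ `Hdg` semi-simple» of the printed `iff` (the direction «semi-simple ⟹
`Hdg ⊂ Sl_{F′}` ⟹ Hodge» needs the connectedness of the algebraic group `Hdg`, which the Tannaka-free carrier does not
record — not claimed):
* §1 **`coe_mem_span_central_pullbackOne_of_mem_center_hodgeGroupOne`** — «`Z(Hdg) ⊂ U_E`» on the carriers: a central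
  element `z` of `Hg|_{H¹}` commutes with `Hg` and with every `ψ^*`, hence lies in the `ℂ`-span of the CENTRAL pull-backs
  `u^*` (the tree's `HodgeGroupSemisimple.mem_span_pullbackOne_of_commute`: Deligne I Prop. 3.4 + Riemann);
  `exists_aeval_eq_coe_of_mem_center_hodgeGroupOne` — so, when `E ⊂ F′`, `z = q(φ^*)` for a polynomial `q ∈ ℂ[T]`.
* §2 **`finite_center_hodgeGroupOne_of_weilClassesField_le_hodgeClassSpan`** — if `E ⊂ F′` and `W_{F′}` consists of Hodge
  classes then the centre of `Hg|_{H¹}` is finite: `z = q(φ^*)` acts on `V_ρ = ker(φ^* − ρ)` by the scalar `q(ρ)`, and «the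
  action of `Hdg` on `W_F` is given by the `F`-linear determinant» (the tree's `Deligne1982.weilClassesField_le_hodgeClassSpan_
  iff_forall_detOnEigenspace_eq_one`) forces `q(ρ)^{2m} = det(z | V_ρ) = 1` at each of the `e` roots; `z` is determined by
  these `e` roots of unity (`H¹ = ⊕_ρ V_ρ`), so there are at most `(2m)^e` central elements;
  **`hasSemisimpleHodgeGroup_of_weilClassesField_le_hodgeClassSpan`** — hence `HasSemisimpleHodgeGroup A`;
  `hasSemisimpleHodgeGroup_of_forall_eigenMultiplicity_eq` — the same from the balanced multiplicities `n_ρ = n_ρ̄`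
  (Criterion (1)); `hasSemisimpleHodgeGroup_of_weilClassesField_le_hodgeClassSpan_of_center_scalar` — the case `E = ℚ`
  (every central pull-back a scalar), where the hypothesis «`E ⊂ F′`» is automatic for every `F′`.

Honesty clause: only the direction «Hodge ⟹ semi-simple (finite centre)» is proved; the hypothesis «`E ⊂ F′`» is taken in
the complexified form stated above; no Weil class is proved algebraic; nothing here concerns decomposability.
No `sorry`; axioms `propext`, `Classical.choice`, `Quot.sound`.

## References
* [MoonenZarhin1998WeilClasses] B. J. J. Moonen, Yu. G. Zarhin, *Weil classes on abelian varieties*, J. reine angew.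
  Math. 496 (1998) 83–92 = arXiv:alg-geom/9612017, §1: Remark (1) after Criterion (2) (chunk p0004), Lemma (1) and (2)
  (chunks p0002–p0003), the Remark after the Criterion («`Hdg(X)` acts on `W_F` through `det_F`»).
* [Deligne1982HodgeCycles] P. Deligne (notes by J. S. Milne), *Hodge cycles on abelian varieties*, LNM 900 (1982), I §3
  Prop. 3.4.
* [vanGeemen1994HodgeAV] B. van Geemen, *An introduction to the Hodge conjecture for abelian varieties*, LNM 1594 (1994),
  6.4–6.10.
* [Gordon1999HodgeAVSurvey] B. B. Gordon, *A survey of the Hodge conjecture for abelian varieties* (Appendix B to Lewis'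
  book, 1999), 1.3 and 2.5 (semisimplicity of the Hodge group).
-/

noncomputable section

open CategoryTheory Polynomial Module

namespace Literature.AlgebraicGeometry.HodgeTheory

open Literature.AlgebraicTopology.SingularHomology
open Literature.AlgebraicGeometry.Motives
open Literature.AlgebraicGeometry.VanGeemen1994 (pullbackOne hodgeClassSpan detOnEigenspace hodgeGroupOne mem_hodgeGroupOne_iff)
open Literature.AlgebraicGeometry.Milne1999 (centralizerAlgebra)

section HodgeTheory

variable {A : AbelianVariety ℂ} {φ : A ⟶ A} {P : Polynomial ℤ} {e m : ℕ}

/-! ### §1 «`Z(Hdg) ⊂ U_E`»: central elements of `Hg|_{H¹}` are combinations of central pull-backs -/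

/-- **«The center `Z(Hdg)` of the Hodge group is contained in the torus `U_E`», on the carriers**: a central element `z` of
`Hg(A)(ℂ)|_{H¹} = hodgeGroupOne` commutes with every `g|_{H¹}`, `g ∈ Hg(A)(ℂ)`, and (being in `Hg`) with every `ψ^*`,
`ψ ∈ End(A)`; hence (Deligne I Prop. 3.4 + Riemann, the tree's `HodgeGroupSemisimple.mem_span_pullbackOne_of_commute`) it
lies in the `ℂ`-span of the CENTRAL pull-backs `u^*` (`u^* ∈ C(A) ⊗ ℂ`), i.e. in `Z(End⁰ A) ⊗ ℂ = E ⊗ ℂ` read on `H¹`.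
[cite: MoonenZarhin1998WeilClasses, §1 Remark (1) after Criterion (2) («Z(Hdg) ⊂ U_E») and Lemma (1)]
[cite: Deligne1982HodgeCycles, I §3 Prop. 3.4] -/
theorem coe_mem_span_central_pullbackOne_of_mem_center_hodgeGroupOne {z : ↥(hodgeGroupOne A.dim A.X)}
    (hz : z ∈ Subgroup.center ↥(hodgeGroupOne A.dim A.X)) :
    ((z : complexBetti A.X 1 ≃ₗ[ℂ] complexBetti A.X 1) : Module.End ℂ (complexBetti A.X 1)) ∈
      Submodule.span ℂ {Y : Module.End ℂ (complexBetti A.X 1) |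
        ∃ u : A ⟶ A, Y = pullbackOne A u ∧ pullbackOne A u ∈ centralizerAlgebra A} := by
  refine HodgeGroupSemisimple.mem_span_pullbackOne_of_commute A _ (fun g hg y => ?_) (fun ψ y => ?_)
  · -- `z` commutes with `g|_{H¹}`
    have hg1 : g 1 ∈ hodgeGroupOne A.dim A.X := mem_hodgeGroupOne_iff.2 ⟨g, hg, rfl⟩
    have h := Subgroup.mem_center_iff.1 hz ⟨g 1, hg1⟩
    have h' := congrArg Subtype.val h
    rw [Subgroup.coe_mul, Subgroup.coe_mul] at h'
    have h'' := LinearEquiv.congr_fun h' y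
    rw [LinearEquiv.mul_apply, LinearEquiv.mul_apply] at h''
    exact h''.symm
  · -- `z ∈ Hg|_{H¹}` commutes with `ψ^*`
    exact hodgeGroupOne_comm_pullbackOne z.2 ψ y

/-- **If `E ⊗ ℂ ⊆ ℂ[φ^*]` («`E ⊂ F′`»), a central element of `Hg|_{H¹}` is a polynomial in `φ^*`**: `z = q(φ^*)` for some
`q ∈ ℂ[T]`. [cite: MoonenZarhin1998WeilClasses, §1 Remark (1) after Criterion (2)] -/
theorem exists_aeval_eq_coe_of_mem_center_hodgeGroupOne
    (hE : ∀ u : A ⟶ A, pullbackOne A u ∈ centralizerAlgebra A → pullbackOne A u ∈ Algebra.adjoin ℂ {pullbackOne A φ})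
    {z : ↥(hodgeGroupOne A.dim A.X)} (hz : z ∈ Subgroup.center ↥(hodgeGroupOne A.dim A.X)) :
    ∃ q : ℂ[X], aeval (pullbackOne A φ) q =
      ((z : complexBetti A.X 1 ≃ₗ[ℂ] complexBetti A.X 1) : Module.End ℂ (complexBetti A.X 1)) := by
  have hmem : ((z : complexBetti A.X 1 ≃ₗ[ℂ] complexBetti A.X 1) : Module.End ℂ (complexBetti A.X 1)) ∈
      Subalgebra.toSubmodule (Algebra.adjoin ℂ {pullbackOne A φ}) := by
    refine (Submodule.span_le.2 ?_) (coe_mem_span_central_pullbackOne_of_mem_center_hodgeGroupOne hz)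
    rintro Y ⟨u, rfl, huC⟩
    exact hE u huC
  rw [Subalgebra.mem_toSubmodule, Algebra.adjoin_singleton_eq_range_aeval] at hmem
  exact hmem

/-! ### §2 `E ⊂ F′` and `W_{F′}` Hodge ⟹ the centre of the Hodge group is finite -/

/-- **MOONEN–ZARHIN 1998, §1, REMARK (1) AFTER CRITERION (2), THE DIRECTION «`W_{F′}` HODGE ⟹ `Hdg` SEMI-SIMPLE» FOR
`F′ ⊇ E`, on `Hg|_{H¹}`.**  Let `P ∈ ℤ[T]` be monic irreducible of degree `e` with `P(φ) = 0`, `e · 2m = 2 dim A`, `m ≠ 0`;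
assume every central pull-back `u^*` is a polynomial in `φ^*` («`E ⊂ F′ = ℚ(φ)`») and `W_{F′} ⊗ ℂ ≤ Bᵐ ⊗ ℂ`.  Then the centre
of `Hg(A)(ℂ)|_{H¹}` is finite: a central `z` is `q(φ^*)` (§1), acting on `V_ρ` by `q(ρ)`; «the action of `Hdg` on `W_F` is
given by the `F`-linear determinant», so `W_{F′}` Hodge gives `q(ρ)^{2m} = det(z | V_ρ) = 1` at every complex root `ρ` of
`P`; and `z` is determined by the `e` scalars `q(ρ)` since `H¹ = ⊕_ρ V_ρ` — at most `(2m)^e` possibilities.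
[cite: MoonenZarhin1998WeilClasses, §1 Remark (1) after Criterion (2) (chunk p0004), Lemma (2) and the Remark after the
Criterion] [cite: Deligne1982HodgeCycles, I §3 Prop. 3.4] -/
theorem finite_center_hodgeGroupOne_of_weilClassesField_le_hodgeClassSpan (hPm : P.Monic) (hPe : P.natDegree = e)
    (hPirr : Irreducible (P.map (Int.castRingHom ℚ)))
    (hφ : Polynomial.eval₂ (Int.castRingHom (CategoryTheory.End A)) (φ : CategoryTheory.End A) P = 0)
    (her : e * (2 * m) = 2 * A.dim) (hm : m ≠ 0)
    (hE : ∀ u : A ⟶ A, pullbackOne A u ∈ centralizerAlgebra A → pullbackOne A u ∈ Algebra.adjoin ℂ {pullbackOne A φ})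
    (hW : weilClassesField A φ P (2 * m) ≤ hodgeClassSpan A.dim A.X m) :
    Finite (Subgroup.center ↥(hodgeGroupOne A.dim A.X)) := by
  classical
  haveI := finite_complexBetti_abelianVariety A 1
  set F : Module.End ℂ (complexBetti A.X 1) := pullbackOne A φ with hFdef
  have hP0 : P ≠ 0 := hPm.ne_zero
  -- `φ^*` is semisimple: `H¹ = ⊕_{P(ρ) = 0} V_ρ`
  have hsepC : (P.map (Int.castRingHom ℂ)).Separable := by
    rw [map_castRingHom_complex_eq]; exact hPirr.separable.map
  have hF0 : aeval F (P.map (Int.castRingHom ℂ)) = 0 := aeval_hom_complexBetti_map_one_eq_zero hφ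
  have hss : F.IsSemisimple := Module.End.isSemisimple_of_squarefree_aeval_eq_zero hsepC.squarefree hF0
  have htop : ⨆ μ, F.eigenspace μ = ⊤ := hss.iSup_eigenspace_eq_top
  have hroot : ∀ μ, F.eigenspace μ ≠ ⊥ → Polynomial.eval₂ (Int.castRingHom ℂ) μ P = 0 := by
    intro μ hμ
    obtain ⟨v, hv, hv0⟩ := (Submodule.ne_bot_iff _).1 hμ
    have h := Module.End.aeval_apply_of_hasEigenvector (f := F) (p := P.map (Int.castRingHom ℂ))
      (Module.End.hasEigenvector_iff.2 ⟨hv, hv0⟩)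
    rw [hF0, LinearMap.zero_apply, Polynomial.eval_map] at h
    exact (smul_eq_zero.1 h.symm).resolve_right hv0
  let Z : Finset ℂ := (P.map (Int.castRingHom ℂ)).roots.toFinset
  have hZ : ∀ μ, μ ∈ Z ↔ Polynomial.eval₂ (Int.castRingHom ℂ) μ P = 0 := mem_roots_toFinset_map_iff hP0
  -- the determinant condition for central (indeed all) elements of `Hg|_{H¹}`
  have hdet := (Deligne1982.weilClassesField_le_hodgeClassSpan_iff_forall_detOnEigenspace_eq_one hPm hPe hPirr hφ
    her).1 hW
  -- the scalar by which a central `z` acts on `V_ρ`: choose `q_z` with `q_z(φ^*) = z`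
  have hq : ∀ z : Subgroup.center ↥(hodgeGroupOne A.dim A.X), ∃ q : ℂ[X], aeval F q =
      (((z : ↥(hodgeGroupOne A.dim A.X)) : complexBetti A.X 1 ≃ₗ[ℂ] complexBetti A.X 1) :
        Module.End ℂ (complexBetti A.X 1)) := fun z => exists_aeval_eq_coe_of_mem_center_hodgeGroupOne hE z.2
  choose q hqz using hq
  -- on `V_ρ`, `z` acts by `q_z(ρ)`
  have hact : ∀ (z : Subgroup.center ↥(hodgeGroupOne A.dim A.X)) (ρ : ℂ), ∀ v ∈ F.eigenspace ρ,
      (((z : ↥(hodgeGroupOne A.dim A.X)) : complexBetti A.X 1 ≃ₗ[ℂ] complexBetti A.X 1) : Module.End ℂ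
        (complexBetti A.X 1)) v = (q z).eval ρ • v := by
    intro z ρ v hv
    rw [← hqz z]
    by_cases hv0 : v = 0
    · rw [hv0, map_zero, smul_zero]
    · exact Module.End.aeval_apply_of_hasEigenvector (Module.End.hasEigenvector_iff.2 ⟨hv, hv0⟩)
  -- `q_z(ρ)^{2m} = 1` at every root
  have hpow : ∀ (z : Subgroup.center ↥(hodgeGroupOne A.dim A.X)) (ρ : ℂ), Polynomial.eval₂ (Int.castRingHom ℂ) ρ P = 0 →
      ((q z).eval ρ) ^ (2 * m) = 1 := by
    intro z ρ hρ
    have hu : ((z : ↥(hodgeGroupOne A.dim A.X)) : complexBetti A.X 1 ≃ₗ[ℂ] complexBetti A.X 1) ∈ hodgeGroupOne A.dim A.X :=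
      (z : ↥(hodgeGroupOne A.dim A.X)).2
    have h1 := hdet _ hu ρ hρ
    -- `det(z | V_ρ) = q_z(ρ)^{dim V_ρ}` and `dim V_ρ = 2m`
    have hres : ((((z : ↥(hodgeGroupOne A.dim A.X)) : complexBetti A.X 1 ≃ₗ[ℂ] complexBetti A.X 1) :
        Module.End ℂ (complexBetti A.X 1)).restrict
        (VanGeemen1994.mapsTo_eigenspace_of_comm (hodgeGroupOne_comm_pullbackOne hu φ) ρ)) =
        (q z).eval ρ • LinearMap.id := by
      refine LinearMap.ext fun v => Subtype.ext ?_
      rw [LinearMap.restrict_apply, LinearMap.smul_apply, LinearMap.id_apply, Submodule.coe_smul]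
      exact hact z ρ v v.2
    have hdim : Module.finrank ℂ ↥(F.eigenspace ρ) = 2 * m := finrank_eigenspace_eq_of_root hPm hPe hPirr hφ her hρ
    unfold detOnEigenspace at h1
    rw [hres, LinearMap.det_smul, LinearMap.det_id, mul_one, hdim] at h1
    exact h1
  -- the map `z ↦ (q_z(ρ))_{ρ ∈ Z}` into a finite set is injective
  have hm2 : 0 < 2 * m := by omega
  let S : Finset ℂ := Polynomial.nthRootsFinset (2 * m) (1 : ℂ)
  let f : Subgroup.center ↥(hodgeGroupOne A.dim A.X) → (↥Z → ↥S) := fun z ρ =>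
    ⟨(q z).eval (ρ : ℂ), (Polynomial.mem_nthRootsFinset hm2 (1 : ℂ)).2 (hpow z ρ ((hZ ρ).1 ρ.2))⟩
  refine Finite.of_injective f fun z₁ z₂ h12 => ?_
  -- equal scalars on every `V_ρ` ⟹ equal on `H¹ = ⊕ V_ρ`
  have hscal : ∀ ρ : ℂ, Polynomial.eval₂ (Int.castRingHom ℂ) ρ P = 0 → (q z₁).eval ρ = (q z₂).eval ρ := by
    intro ρ hρ
    have h := congr_fun h12 ⟨ρ, (hZ ρ).2 hρ⟩
    exact congrArg Subtype.val h
  have heqV : ∀ v : complexBetti A.X 1,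
      (((z₁ : ↥(hodgeGroupOne A.dim A.X)) : complexBetti A.X 1 ≃ₗ[ℂ] complexBetti A.X 1) : Module.End ℂ
        (complexBetti A.X 1)) v =
      (((z₂ : ↥(hodgeGroupOne A.dim A.X)) : complexBetti A.X 1 ≃ₗ[ℂ] complexBetti A.X 1) : Module.End ℂ
        (complexBetti A.X 1)) v := by
    intro v
    have hv : v ∈ ⨆ μ, F.eigenspace μ := by rw [htop]; exact Submodule.mem_top
    induction hv using Submodule.iSup_induction' with
    | mem μ w hw =>
      by_cases hμ : F.eigenspace μ = ⊥
      · rw [hμ, Submodule.mem_bot] at hw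
        rw [hw, map_zero, map_zero]
      · rw [hact z₁ μ w hw, hact z₂ μ w hw, hscal μ (hroot μ hμ)]
    | zero => rw [map_zero, map_zero]
    | add w w' _ _ hw hw' => rw [map_add, map_add, hw, hw']
  apply Subtype.ext
  apply Subtype.ext
  exact LinearEquiv.ext heqV

/-- **… hence `Hg(A)` is semi-simple in the tree's sense (`HasSemisimpleHodgeGroup A`: finite centre)** — «if
`E ⊂ F′`, then `W_{F′}` consists of Hodge classes [⟹] `Hdg` is semi-simple» (transfer from `Hg|_{H¹}` by the tree's
`VanGeemen1994.finite_center_hodgeGroup_of_hodgeGroupOne`). [cite: MoonenZarhin1998WeilClasses, §1 Remark (1) after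
Criterion (2) (chunk p0004)] [cite: Gordon1999HodgeAVSurvey, 1.3 and 2.5] -/
theorem hasSemisimpleHodgeGroup_of_weilClassesField_le_hodgeClassSpan (hPm : P.Monic) (hPe : P.natDegree = e)
    (hPirr : Irreducible (P.map (Int.castRingHom ℚ)))
    (hφ : Polynomial.eval₂ (Int.castRingHom (CategoryTheory.End A)) (φ : CategoryTheory.End A) P = 0)
    (her : e * (2 * m) = 2 * A.dim) (hm : m ≠ 0)
    (hE : ∀ u : A ⟶ A, pullbackOne A u ∈ centralizerAlgebra A → pullbackOne A u ∈ Algebra.adjoin ℂ {pullbackOne A φ})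
    (hW : weilClassesField A φ P (2 * m) ≤ hodgeClassSpan A.dim A.X m) : HasSemisimpleHodgeGroup A :=
  VanGeemen1994.finite_center_hodgeGroup_of_hodgeGroupOne A
    (finite_center_hodgeGroupOne_of_weilClassesField_le_hodgeClassSpan hPm hPe hPirr hφ her hm hE hW)

/-- **… from balanced multiplicities**: for `F′ ⊇ E` as above, `n_ρ = n_ρ̄` at every complex root of `P` (Criterion (1),
`W_{F′}` Hodge) ⟹ `HasSemisimpleHodgeGroup A`. [cite: MoonenZarhin1998WeilClasses, §1 Criterion and Remark (1) after
Criterion (2)] -/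
theorem hasSemisimpleHodgeGroup_of_forall_eigenMultiplicity_eq (hPm : P.Monic) (hPe : P.natDegree = e)
    (hPirr : Irreducible (P.map (Int.castRingHom ℚ)))
    (hφ : Polynomial.eval₂ (Int.castRingHom (CategoryTheory.End A)) (φ : CategoryTheory.End A) P = 0)
    (her : e * (2 * m) = 2 * A.dim) (hm : m ≠ 0)
    (hE : ∀ u : A ⟶ A, pullbackOne A u ∈ centralizerAlgebra A → pullbackOne A u ∈ Algebra.adjoin ℂ {pullbackOne A φ})
    (hbal : ∀ ρ : ℂ, Polynomial.eval₂ (Int.castRingHom ℂ) ρ P = 0 →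
      eigenMultiplicity A φ ρ = eigenMultiplicity A φ (starRingEnd ℂ ρ)) :
    HasSemisimpleHodgeGroup A :=
  hasSemisimpleHodgeGroup_of_weilClassesField_le_hodgeClassSpan hPm hPe hPirr hφ her hm hE
    ((Deligne1982.weilClassesField_le_hodgeClassSpan_iff_forall_eigenMultiplicity_eq hPm hPe hPirr hφ her).2 hbal)

/-- **The case `E = ℚ`** (every central pull-back is a scalar — the centre of `End⁰(A)` is `ℚ`, e.g. `A ∼ Yᵐ` with `Y`
simple of type I with `E = ℚ`, of type II or III with centre `ℚ`): then «`E ⊂ F′`» holds for EVERY subfield `F′ = ℚ(φ)`,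
and `W_{F′}` Hodge ⟹ `HasSemisimpleHodgeGroup A`. [cite: MoonenZarhin1998WeilClasses, §1 Remark (1) after Criterion (2)
and Lemma (1) («in all other cases it is finite»)] -/
theorem hasSemisimpleHodgeGroup_of_weilClassesField_le_hodgeClassSpan_of_center_scalar (hPm : P.Monic)
    (hPe : P.natDegree = e) (hPirr : Irreducible (P.map (Int.castRingHom ℚ)))
    (hφ : Polynomial.eval₂ (Int.castRingHom (CategoryTheory.End A)) (φ : CategoryTheory.End A) P = 0)
    (her : e * (2 * m) = 2 * A.dim) (hm : m ≠ 0)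
    (hE : ∀ u : A ⟶ A, pullbackOne A u ∈ centralizerAlgebra A → ∃ c : ℂ, pullbackOne A u = c • 1)
    (hW : weilClassesField A φ P (2 * m) ≤ hodgeClassSpan A.dim A.X m) : HasSemisimpleHodgeGroup A := by
  refine hasSemisimpleHodgeGroup_of_weilClassesField_le_hodgeClassSpan hPm hPe hPirr hφ her hm (fun u huC => ?_) hW
  obtain ⟨c, hc⟩ := hE u huC
  rw [hc]
  exact Subalgebra.smul_mem _ (Subalgebra.one_mem _) c

end HodgeTheory

end Literature.AlgebraicGeometry.HodgeTheory

end
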